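import Mathlib
import HarnessLib

/-!
# A collinear boundary trace forces a disc-holomorphic function to be constant

Stub `stub_collinearTraceConstant` of the line Sketch (idea card potential-darboux-picard-diamond)
for the crux `ParafermionToSLESixFamilies`: a function `Φ` holomorphic on the open unit disc and
continuous on the closed disc, all of whose boundary values lie on one real line
`{w | im (exp (-α I) * w) = c}`, is constant on the open disc.

Proof: `g := exp (-α I) * Φ - c I` is real on the unit circle; the maximum modulus principle for
`exp (I * g)` and `exp (-(I * g))` on the disc gives `im g = 0` on the open disc, and a
holomorphic function with real values on a connected open set is constant by the open mapping
theorem. Pure complex analysis (Mathlib only).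
-/

open Set Metric Complex

namespace Summit.CriticalPhenomena.CardyFormulaZ2.Cruxes.ParafermionToSLESixFamilies.PotentialDarbouxPicard

/-- Every point of the unit circle is `exp (t I)` for some real `t`. -/
private lemma exists_exp_ofReal_mul_I_eq {w : ℂ} (hw : w ∈ sphere (0 : ℂ) 1) :
    ∃ t : ℝ, Complex.exp ((t : ℂ) * I) = w := by
  refine ⟨Complex.arg w, ?_⟩
  have h := Complex.norm_mul_exp_arg_mul_I w
  rw [mem_sphere_zero_iff_norm] at hw
  rw [hw, Complex.ofReal_one, one_mul] at h
  exact h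

/-- Minimum principle for the imaginary part: if `g` is holomorphic on the open unit disc,
continuous on the closed disc and `0 ≤ im g` on the unit circle, then `0 ≤ im g` on the open
disc (maximum modulus principle for `exp (I * g)`, whose modulus is `exp (-im g)`). -/
private lemma im_nonneg_of_sphere {g : ℂ → ℂ} (hgd : DifferentiableOn ℂ g (ball (0 : ℂ) 1))
    (hgc : ContinuousOn g (closedBall (0 : ℂ) 1))
    (hgb : ∀ w ∈ sphere (0 : ℂ) 1, 0 ≤ (g w).im) {z : ℂ} (hz : z ∈ ball (0 : ℂ) 1) :
    0 ≤ (g z).im := by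
  set h : ℂ → ℂ := fun w ↦ exp (I * g w) with hh
  have hnorm : ∀ w, ‖h w‖ = Real.exp (-(g w).im) := fun w ↦ by
    simp only [hh, norm_exp, mul_re, I_re, zero_mul, I_im, one_mul, zero_sub]
  have hcl : closure (ball (0 : ℂ) 1) = closedBall 0 1 := closure_ball 0 one_ne_zero
  have hdc : DiffContOnCl ℂ h (ball (0 : ℂ) 1) := by
    refine ⟨((differentiableOn_const I).mul hgd).cexp, ?_⟩
    rw [hcl]
    exact (continuousOn_const.mul hgc).cexp
  have hfr : ∀ w ∈ frontier (ball (0 : ℂ) 1), ‖h w‖ ≤ 1 := by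
    intro w hw
    rw [frontier_ball 0 one_ne_zero] at hw
    rw [hnorm, Real.exp_le_one_iff]
    linarith [hgb w hw]
  have key := norm_le_of_forall_mem_frontier_norm_le isBounded_ball hdc hfr (subset_closure hz)
  rw [hnorm, Real.exp_le_one_iff] at key
  linarith

/-- **Collinear-trace dichotomy, constant case.** Let `Φ` be holomorphic on the open unit disc and
continuous on the closed unit disc, and suppose all its boundary values lie on one real line:
`im (exp (-α I) * Φ (exp (t I))) = c` for every real `t`. Then `Φ` is constant on the open disc. -/
theorem stub_collinearTraceConstant : ∀ (Φ : ℂ → ℂ) (α c : ℝ), DifferentiableOn ℂ Φ (Metric.ball (0 : ℂ) 1) → ContinuousOn Φ (Metric.closedBall (0 : ℂ) 1) → (∀ t : ℝ, (Complex.exp (-((α : ℂ) * Complex.I)) * Φ (Complex.exp ((t : ℂ) * Complex.I))).im = c) → ∀ z ∈ Metric.ball (0 : ℂ) 1, Φ z = Φ 0 := by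
  intro Φ α c hd hc hb z hz
  have h0 : (0 : ℂ) ∈ ball (0 : ℂ) 1 := mem_ball_self one_pos
  -- the rotated and shifted function `g` is real on the unit circle
  set g : ℂ → ℂ := fun w ↦ exp (-((α : ℂ) * I)) * Φ w - (c : ℂ) * I with hg
  have hgd : DifferentiableOn ℂ g (ball (0 : ℂ) 1) :=
    ((differentiableOn_const _).mul hd).sub (differentiableOn_const _)
  have hgc : ContinuousOn g (closedBall (0 : ℂ) 1) :=
    (continuousOn_const.mul hc).sub continuousOn_const
  have hgb : ∀ w ∈ sphere (0 : ℂ) 1, (g w).im = 0 := by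
    intro w hw
    obtain ⟨t, rfl⟩ := exists_exp_ofReal_mul_I_eq hw
    simp only [hg]
    rw [sub_im, hb t, mul_im, ofReal_re, ofReal_im, I_re, I_im]
    ring
  -- by the minimum principle for `im g` and `im (-g)`, `im g = 0` on the open disc
  have him : ∀ w ∈ ball (0 : ℂ) 1, (g w).im = 0 := by
    intro w hw
    refine le_antisymm ?_ (im_nonneg_of_sphere hgd hgc (fun v hv ↦ (hgb v hv).ge) hw)
    have hneg := im_nonneg_of_sphere hgd.fun_neg hgc.fun_neg
      (fun v hv ↦ by rw [neg_im, hgb v hv, neg_zero]) hw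
    rw [neg_im] at hneg
    linarith
  -- a holomorphic function with real values on the disc is constant (open mapping theorem)
  have hconst : g z = g 0 := by
    have hga : AnalyticOnNhd ℂ g (ball (0 : ℂ) 1) := hgd.analyticOnNhd isOpen_ball
    rcases hga.is_constant_or_isOpen (convex_ball (0 : ℂ) 1).isPreconnected with ⟨w, hw⟩ | hopen
    · rw [hw z hz, hw 0 h0]
    · exfalso
      have ho : IsOpen (g '' ball (0 : ℂ) 1) := hopen _ Subset.rfl isOpen_ball
      obtain ⟨r, hr, hsub⟩ := Metric.isOpen_iff.1 ho (g 0) (mem_image_of_mem g h0)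
      have hmem : g 0 + ((r / 2 : ℝ) : ℂ) * I ∈ ball (g 0) r := by
        rw [mem_ball, dist_eq_norm, add_sub_cancel_left, norm_mul, norm_I, mul_one,
          norm_real, Real.norm_eq_abs, abs_of_pos (by positivity)]
        linarith
      obtain ⟨v, hv, hgv⟩ := hsub hmem
      have h1 := him v hv
      rw [hgv, add_im, him 0 h0, mul_im, ofReal_re, ofReal_im, I_re, I_im] at h1
      linarith
  -- undo the rotation and the shift
  have hΦ : ∀ w, Φ w = exp ((α : ℂ) * I) * (g w + (c : ℂ) * I) := fun w ↦ by
    simp only [hg]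
    rw [sub_add_cancel, ← mul_assoc, ← Complex.exp_add, add_neg_cancel, Complex.exp_zero,
      one_mul]
  rw [hΦ z, hΦ 0, hconst]

end Summit.CriticalPhenomena.CardyFormulaZ2.Cruxes.ParafermionToSLESixFamilies.PotentialDarbouxPicard
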